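import Mathlib
import Summits.CriticalPhenomena.Ising3DConformalLimit.Theses.GaussianScaleMixture
import Literature.Analysis.SpecialFunctions.IsStieltjesFunction

/-!
# `GSMRigidity` (item stmt-CriticalPhenomena-8366): tightness of the lines' stub hypotheses, the x-side lever sign, the massive circle lemma

Negative-lane lemmas of the standing crux disprover (cycle 3, seat g3; D-0016) for the crux
`Summit.CriticalPhenomena.Ising3DConformalLimit.Theses.GaussianScaleMixture.GSMRigidity`, split off the work
file `Summits/CriticalPhenomena/Ising3DConformalLimit/Cruxes/GSMRigidity/Disproof.lean` (findings F11, F12, F14).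
No stub of the three registered lines (`Cruxes/GSMRigidity/Lines/*.lean`) is refuted — all fifteen were audited
TRUE; two stub HYPOTHESES are shown necessary. None of the lemmas asserts a Theses statement.

* `stieltjesHalfPlane_false_at_beta_half` — stub `stub_stieltjesHalfPlane` (line `momentum-one-amplitude`, S4)
  with `1 ≤ β` weakened to `1/2 ≤ β` is FALSE: `g s = (s+1)⁻¹` is Stieltjes with `g(r²) ≤ r^{-1/2}`, its unique
  continuation `(t²+1)⁻¹` has `‖F(1/9 + i)‖ = 81/√325 > 3 = (Re t)^{-1/2}`. That line uses the upper end
  `Δ ≤ 1` of the window (`β = 3 - 2Δ`) essentially.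
* `oneAmplitudeMomentum_false_without_exchangeability` — stub `stub_oneAmplitudeMomentum` (same line, S5)
  without exchangeability of the mixing measure is FALSE (`ν = δ_{(1,1,2)}`).
* `eqOn_rhp_of_eqOn_ofReal` — identity theorem on the right half-plane from the positive reals.
* `im_cpow_neg_neg`, `im_cpow_neg_pos` — the x-side lever has a SIGN: `Im (w - c)^{-Δ} < 0` on the upper
  half-plane (`> 0` on the lower) for real `c`, `0 < Δ ≤ 1` (principal branch): every term of the order-`Δ`
  Stieltjes transform of `stub_sliceNoMass_lt_one` (line `tilted-lightcone-jump-positivity`) has one sign.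
* `swapSlice_factor_massive` — the MASSIVE circle lemma: a Gaussian-scale-mixture component with a mass `m`
  has its swap-pencil roots on the circle of squared radius `k² + m²·2ω₁ω₂/(ω₁+ω₂)`, one circle per atom —
  the one place where the paper proof of the crux (work file F3) uses homogeneity (F12).

No definitions.
-/

noncomputable section

open scoped BigOperators Topology
open MeasureTheory Set Filter Literature.Analysis.SpecialFunctions

namespace Summit.CriticalPhenomena.Ising3DConformalLimit.Theorems.GSMRigidity.Negative

/-- **No circle lemma for MASSIVE atoms — where F3 uses homogeneity (F12).** On the transverse momentum
`q = k (e₁+e₂)/√2`, `k₃ = 0`, the swap pencil of a massive Gaussian-scale-mixture component of shape `ω`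
and mass `m` vanishes at the roots of `a_ω (t² - 2ρ_ω k t + k²) + m²`; by Vieta their product is
`k² + m² · 2ω₁ω₂/(ω₁+ω₂)`, which DEPENDS ON THE ATOM unless `m = 0`: massive components of different
shapes are singular on different circles and the inside/outside gluing of F3 Step 3 says nothing
(compare `swapSlice_factor_offplane`: `m²` plays the part of `k_w²/ω₃`). -/
theorem swapSlice_factor_massive {ω₁ ω₂ : ℝ} (h₁ : 0 < ω₁) (h₂ : 0 < ω₂) (k t m : ℝ) :
    (1 / ω₁ + 1 / ω₂) / 2 * t ^ 2 + (1 / ω₁ - 1 / ω₂) * (k * t) + (1 / ω₁ + 1 / ω₂) / 2 * k ^ 2 + m ^ 2 =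
      (1 / ω₁ + 1 / ω₂) / 2 *
        (t ^ 2 - 2 * ((ω₁ - ω₂) / (ω₁ + ω₂)) * (k * t) +
          (k ^ 2 + m ^ 2 * (2 * ω₁ * ω₂ / (ω₁ + ω₂)))) := by
  have h12 : ω₁ + ω₂ ≠ 0 := by positivity
  have h1 : ω₁ ≠ 0 := h₁.ne'
  have h2 : ω₂ ≠ 0 := h₂.ne'
  field_simp
  ring

/-- Two functions holomorphic on the open right half-plane that agree on the positive reals agree.
[folklore] -/
theorem eqOn_rhp_of_eqOn_ofReal {F G : ℂ → ℂ} (hF : DifferentiableOn ℂ F {t : ℂ | 0 < t.re})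
    (hG : DifferentiableOn ℂ G {t : ℂ | 0 < t.re}) (h : ∀ t : ℝ, 0 < t → F t = G t) :
    EqOn F G {t : ℂ | 0 < t.re} := by
  have hopen : IsOpen {t : ℂ | 0 < t.re} := isOpen_lt continuous_const Complex.continuous_re
  have hconn : IsPreconnected {t : ℂ | 0 < t.re} := (convex_halfSpace_re_gt 0).isPreconnected
  have hFa : AnalyticOnNhd ℂ F {t : ℂ | 0 < t.re} := hF.analyticOnNhd hopen
  have hGa : AnalyticOnNhd ℂ G {t : ℂ | 0 < t.re} := hG.analyticOnNhd hopen
  have h1 : (1 : ℂ) ∈ {t : ℂ | 0 < t.re} := by simp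
  refine hFa.eqOn_of_preconnected_of_frequently_eq hGa hconn h1 ?_
  have hu : Tendsto (fun n : ℕ => (((1 : ℝ) + 1 / ((n : ℝ) + 1) : ℝ) : ℂ)) atTop (𝓝[≠] (1 : ℂ)) := by
    rw [tendsto_nhdsWithin_iff]
    constructor
    · have h0 : Tendsto (fun n : ℕ => (1 : ℝ) + 1 / ((n : ℝ) + 1)) atTop (𝓝 1) := by
        simpa using (tendsto_one_div_add_atTop_nhds_zero_nat.const_add (1 : ℝ))
      have h1' := (Complex.continuous_ofReal.tendsto (1 : ℝ)).comp h0
      simpa [Function.comp_def] using h1'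
    · refine Eventually.of_forall fun n => ?_
      simp only [mem_compl_iff, mem_singleton_iff]
      intro heq
      have hre := congrArg Complex.re heq
      simp only [Complex.ofReal_re, Complex.one_re] at hre
      have : (0 : ℝ) < 1 / ((n : ℝ) + 1) := by positivity
      linarith
  refine hu.frequently (Frequently.of_forall fun n => ?_)
  exact h _ (by positivity)

/-- **Tightness of stub `stub_stieltjesHalfPlane` (line `momentum-one-amplitude`, S4): `1 ≤ β` cannot be
weakened to `1/2 ≤ β`.** Witness `g s = (s + 1)⁻¹` (Stieltjes), `β = 1/2`, `M₀ = 1`: `g(r²) ≤ r^{-1/2}`,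
the only holomorphic `F` on `Re t > 0` with `F t = g(t²)` on the positive reals is `(t² + 1)⁻¹`
(`eqOn_rhp_of_eqOn_ofReal`), and at `t = 1/9 + i`: `‖F t‖ = 81/√325 > 3 = (Re t)^{-1/2}`. So for THIS
line the upper end `Δ ≤ 1` of the window (`β = 3 - 2Δ ≥ 1`) is load-bearing; F3 and the x-side line do
not use it (F4/F9(v)). -/
theorem stieltjesHalfPlane_false_at_beta_half :
    ¬ (∀ (g : ℝ → ℝ) (β M₀ : ℝ), IsStieltjesFunction g → 1 / 2 ≤ β →
      (∀ r : ℝ, 0 < r → g (r ^ 2) ≤ M₀ * r ^ (-β)) →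
      ∃ F : ℂ → ℂ, DifferentiableOn ℂ F {t : ℂ | 0 < t.re} ∧
        (∀ t : ℝ, 0 < t → F t = ((g (t ^ 2) : ℝ) : ℂ)) ∧
        ∀ t : ℂ, 0 < t.re → ‖F t‖ ≤ M₀ * t.re ^ (-β)) := by
  intro h
  have hg : IsStieltjesFunction (fun s : ℝ => (s + 1)⁻¹) := isStieltjesFunction_inv_add_const_of_pos one_pos
  have hdec : ∀ r : ℝ, 0 < r → (fun s : ℝ => (s + 1)⁻¹) (r ^ 2) ≤ 1 * r ^ (-(1 / 2 : ℝ)) := by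
    intro r hr
    simp only [one_mul]
    rw [Real.rpow_neg hr.le]
    have hsqrt_le : r ^ (1 / 2 : ℝ) ≤ r ^ 2 + 1 := by
      rcases le_or_gt r 1 with hr1 | hr1
      · have : r ^ (1 / 2 : ℝ) ≤ 1 := Real.rpow_le_one hr.le hr1 (by norm_num)
        nlinarith [sq_nonneg r]
      · have h1 : r ^ (1 / 2 : ℝ) ≤ r ^ (1 : ℝ) :=
          Real.rpow_le_rpow_of_exponent_le hr1.le (by norm_num)
        rw [Real.rpow_one] at h1
        nlinarith
    have hpos : 0 < r ^ (1 / 2 : ℝ) := Real.rpow_pos_of_pos hr _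
    exact inv_anti₀ hpos hsqrt_le
  obtain ⟨F, hF, hFreal, hFbound⟩ := h (fun s => (s + 1)⁻¹) (1 / 2) 1 hg le_rfl hdec
  -- the competitor `G t = (t² + 1)⁻¹`, holomorphic on the right half-plane
  set G : ℂ → ℂ := fun t => (t ^ 2 + 1)⁻¹ with hGdef
  have hne : ∀ t : ℂ, 0 < t.re → t ^ 2 + 1 ≠ 0 := by
    intro t ht h0
    have hre := congrArg Complex.re h0
    have him := congrArg Complex.im h0
    simp only [Complex.add_re, Complex.one_re, Complex.zero_re, Complex.add_im, Complex.one_im,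
      Complex.zero_im, add_zero, sq, Complex.mul_re, Complex.mul_im] at hre him
    have him' : 2 * t.re * t.im = 0 := by linarith
    rcases mul_eq_zero.1 him' with h2 | h2
    · have : t.re = 0 := by linarith
      linarith
    · rw [h2, mul_zero, sub_zero] at hre
      nlinarith
  have hG : DifferentiableOn ℂ G {t : ℂ | 0 < t.re} := by
    intro t ht
    have hd : DifferentiableAt ℂ (fun t : ℂ => t ^ 2 + 1) t := by fun_prop
    exact (hd.inv (hne t ht)).differentiableWithinAt
  have hFG : EqOn F G {t : ℂ | 0 < t.re} := by
    refine eqOn_rhp_of_eqOn_ofReal hF hG fun t ht => ?_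
    rw [hFreal t ht, hGdef]
    push_cast
    ring
  -- evaluate at `t₀ = 1/9 + i`
  set t₀ : ℂ := (1 / 9 : ℂ) + Complex.I with ht₀
  have ht₀re : t₀.re = 1 / 9 := by simp [ht₀]
  have ht₀mem : t₀ ∈ {t : ℂ | 0 < t.re} := by
    simp only [mem_setOf_eq, ht₀re]; norm_num
  have hsq : t₀ ^ 2 + 1 = ⟨1 / 81, 2 / 9⟩ := by
    apply Complex.ext <;> simp [ht₀, sq] <;> norm_num
  have hnorm : ‖t₀ ^ 2 + 1‖ < 1 / 3 := by
    rw [hsq, Complex.norm_def, Complex.normSq_mk]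
    rw [show (1 / 3 : ℝ) = Real.sqrt (1 / 9) by
      rw [show (1 / 9 : ℝ) = (1 / 3) ^ 2 by norm_num, Real.sqrt_sq (by norm_num)]]
    exact Real.sqrt_lt_sqrt (by positivity) (by norm_num)
  have hGbig : 3 < ‖G t₀‖ := by
    simp only [hGdef, norm_inv]
    have hpos : 0 < ‖t₀ ^ 2 + 1‖ := norm_pos_iff.2 (hne t₀ ht₀mem)
    rw [lt_inv_comm₀ (by norm_num) hpos]
    simpa using hnorm
  have hbound := hFbound t₀ ht₀mem
  rw [hFG ht₀mem, ht₀re, one_mul] at hbound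
  have hrpow : (1 / 9 : ℝ) ^ (-(1 / 2 : ℝ)) = 3 := by
    rw [Real.rpow_neg (by norm_num), one_div, Real.inv_rpow (by norm_num), inv_inv,
      show (9 : ℝ) = (3 : ℝ) ^ (2 : ℕ) by norm_num, ← Real.rpow_natCast,
      ← Real.rpow_mul (by norm_num)]
    norm_num
  rw [hrpow] at hbound
  linarith

/-- **Tightness of stub `stub_oneAmplitudeMomentum` (line `momentum-one-amplitude`, S5): EXCHANGEABILITY
of the mixing measure is load-bearing.** Drop it and the one-amplitude identity `D_ν(1,0) = D_ν(1/2,1/2)`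
no longer forces isotropy: `ν = δ_{(1,1,2)}`, `K x = exp(-(x₀² + x₁² + 2x₂²))` has equal dual
amplitudes at `e₀` and `(e₀+e₁)/√2` (the identity only sees `s₀ = s₁`) but `K(e₂) = e⁻² ≠ e⁻¹ = K(e₀)`. -/
theorem oneAmplitudeMomentum_false_without_exchangeability :
    ¬ (∀ (K : EuclideanSpace ℝ (Fin 3) → ℝ) (ν : Measure (Fin 3 → ℝ)),
      ν {s | ∃ i, s i ≤ 0} = 0 →
      (∀ x, x ≠ 0 → Integrable (fun s => Real.exp (-∑ i, s i * (x i) ^ 2)) ν ∧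
          K x = ∫ s, Real.exp (-∑ i, s i * (x i) ^ 2) ∂ν) →
      Integrable (fun s : Fin 3 → ℝ => (s 0 * s 1 * s 2) ^ (-(1/2:ℝ)) *
        Real.exp (-(((1:ℝ)) / (4 * s 0) + ((0:ℝ)) / (4 * s 1)))) ν →
      Integrable (fun s : Fin 3 → ℝ => (s 0 * s 1 * s 2) ^ (-(1/2:ℝ)) *
        Real.exp (-(((1/2:ℝ)) / (4 * s 0) + ((1/2:ℝ)) / (4 * s 1)))) ν →
      ∫ s, (s 0 * s 1 * s 2) ^ (-(1/2:ℝ)) * Real.exp (-(((1:ℝ)) / (4 * s 0) + ((0:ℝ)) / (4 * s 1))) ∂ν =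
        ∫ s, (s 0 * s 1 * s 2) ^ (-(1/2:ℝ)) * Real.exp (-(((1/2:ℝ)) / (4 * s 0) + ((1/2:ℝ)) / (4 * s 1))) ∂ν →
      ∀ (R : EuclideanSpace ℝ (Fin 3) ≃ₗᵢ[ℝ] EuclideanSpace ℝ (Fin 3)) (x : EuclideanSpace ℝ (Fin 3)),
        K (R x) = K x) := by
  intro h
  set s₀ : Fin 3 → ℝ := ![1, 1, 2] with hs₀
  set K : EuclideanSpace ℝ (Fin 3) → ℝ := fun x => Real.exp (-∑ i, s₀ i * (x i) ^ 2) with hK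
  set ν : Measure (Fin 3 → ℝ) := Measure.dirac s₀ with hν
  have hint : ∀ f : (Fin 3 → ℝ) → ℝ, Integrable f ν := fun f =>
    (integrable_const (f s₀)).congr (ae_eq_dirac f).symm
  have hoct : ν {s | ∃ i, s i ≤ 0} = 0 := by
    rw [hν, Measure.dirac_apply, Set.indicator_of_notMem]
    simp only [mem_setOf_eq, not_exists, not_le]
    intro i; fin_cases i <;> simp [hs₀]
  have hrep : ∀ x : EuclideanSpace ℝ (Fin 3), x ≠ 0 →
      Integrable (fun s => Real.exp (-∑ i, s i * (x i) ^ 2)) ν ∧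
        K x = ∫ s, Real.exp (-∑ i, s i * (x i) ^ 2) ∂ν := fun x _ =>
    ⟨hint _, by rw [hν, integral_dirac]⟩
  have hamp : ∫ s, (s 0 * s 1 * s 2) ^ (-(1/2:ℝ)) * Real.exp (-(((1:ℝ)) / (4 * s 0) + ((0:ℝ)) / (4 * s 1))) ∂ν =
      ∫ s, (s 0 * s 1 * s 2) ^ (-(1/2:ℝ)) * Real.exp (-(((1/2:ℝ)) / (4 * s 0) + ((1/2:ℝ)) / (4 * s 1))) ∂ν := by
    rw [hν, integral_dirac, integral_dirac]
    simp [hs₀]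
    norm_num
  have key := h K ν hoct hrep (hint _) (hint _) hamp
    (LinearIsometryEquiv.piLpCongrLeft 2 ℝ ℝ (Equiv.swap (0 : Fin 3) 2)) (EuclideanSpace.single 0 1)
  have h1 : K (LinearIsometryEquiv.piLpCongrLeft 2 ℝ ℝ (Equiv.swap (0 : Fin 3) 2)
      (EuclideanSpace.single 0 1)) = Real.exp (-2) := by
    simp [hK, hs₀, Fin.sum_univ_three, Equiv.swap_apply_left]
  have h2 : K (EuclideanSpace.single 0 1) = Real.exp (-1) := by
    simp [hK, hs₀, Fin.sum_univ_three]
  rw [h1, h2] at key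
  have := Real.exp_injective key
  norm_num at this

/-- **For `Im w > 0`, real `c` and `0 < Δ ≤ 1`: `Im (w - c)^{-Δ} < 0`** (principal branch). Every term of
`Im ∫ (w - c)^{-Δ} dρ(c)` is negative on the upper half-plane — the one-signedness behind the boundary
jump of the order-`Δ` Stieltjes transform in `stub_sliceNoMass_lt_one` (line
`tilted-lightcone-jump-positivity`), the x-side twin of `arcBase_eq` + `jumpIntegrand_pos`. -/
theorem im_cpow_neg_neg {w : ℂ} (hw : 0 < w.im) (c : ℝ) {Δ : ℝ} (h0 : 0 < Δ) (h1 : Δ ≤ 1) :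
    ((w - c) ^ (-(Δ : ℂ))).im < 0 := by
  set z : ℂ := w - c with hz
  have hzim : z.im = w.im := by simp [hz]
  have hz0 : z ≠ 0 := by
    intro h; rw [h] at hzim; simp at hzim; linarith
  have harg_pos : 0 < Complex.arg z := by
    rcases lt_trichotomy (Complex.arg z) 0 with hlt | heq | hgt
    · exact absurd (Complex.arg_neg_iff.1 hlt) (by rw [hzim]; exact not_lt.2 hw.le)
    · exfalso
      have := Complex.arg_eq_zero_iff.1 heq
      rw [hzim] at this
      linarith [this.2]
    · exact hgt
  have harg_lt : Complex.arg z < Real.pi := by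
    rw [Complex.arg_lt_pi_iff]
    exact Or.inr (by rw [hzim]; exact hw.ne')
  rw [Complex.cpow_def_of_ne_zero hz0, Complex.exp_im]
  have hre : (Complex.log z * -(Δ : ℂ)).im = -(Δ * Complex.arg z) := by
    simp [Complex.log_im, mul_comm]
  rw [hre, Real.sin_neg]
  have hsin : 0 < Real.sin (Δ * Complex.arg z) := by
    apply Real.sin_pos_of_pos_of_lt_pi (mul_pos h0 harg_pos)
    calc Δ * Complex.arg z ≤ 1 * Complex.arg z := by gcongr
      _ < Real.pi := by rw [one_mul]; exact harg_lt
  have hexp : 0 < Real.exp (Complex.log z * -(Δ : ℂ)).re := Real.exp_pos _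
  nlinarith

/-- Companion on the lower half-plane: `Im w < 0 ⇒ 0 < Im (w - c)^{-Δ}` (`0 < Δ ≤ 1`). -/
theorem im_cpow_neg_pos {w : ℂ} (hw : w.im < 0) (c : ℝ) {Δ : ℝ} (h0 : 0 < Δ) (h1 : Δ ≤ 1) :
    0 < ((w - c) ^ (-(Δ : ℂ))).im := by
  set z : ℂ := w - c with hz
  have hzim : z.im = w.im := by simp [hz]
  have hz0 : z ≠ 0 := by
    intro h; rw [h] at hzim; simp at hzim; linarith
  have harg_neg : Complex.arg z < 0 := Complex.arg_neg_iff.2 (by rw [hzim]; exact hw)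
  have harg_gt : -Real.pi < Complex.arg z := Complex.neg_pi_lt_arg z
  rw [Complex.cpow_def_of_ne_zero hz0, Complex.exp_im]
  have hre : (Complex.log z * -(Δ : ℂ)).im = -(Δ * Complex.arg z) := by
    simp [Complex.log_im, mul_comm]
  rw [hre]
  have hsin : 0 < Real.sin (-(Δ * Complex.arg z)) := by
    apply Real.sin_pos_of_pos_of_lt_pi
    · nlinarith
    · calc -(Δ * Complex.arg z) = Δ * (-Complex.arg z) := by ring
        _ ≤ 1 * (-Complex.arg z) := by gcongr; linarith
        _ < Real.pi := by linarith
  exact mul_pos (Real.exp_pos _) hsin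

end Summit.CriticalPhenomena.Ising3DConformalLimit.Theorems.GSMRigidity.Negative
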